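import Literature.NumberTheory.EllipticCurves.LocalTorsionAdditiveReductionPPrimaryProofs
import Literature.NumberTheory.EllipticCurves.GoodReductionTorsionReductionProofs
import Literature.NumberTheory.EllipticCurves.CanonicalPAdicHeightThetaProofs
import Literature.NumberTheory.EllipticCurves.NeronComponentIndexProofs
import Literature.NumberTheory.EllipticCurves.NeronComponentIndexTypeIIIProofs
import Literature.NumberTheory.EllipticCurves.NeronComponentIndexTypeIVProofs
import Literature.NumberTheory.EllipticCurves.NeronComponentIndexTypeIIIstarProofs
import Literature.NumberTheory.EllipticCurves.NeronComponentIndexTypeIVstarProofs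
import Literature.NumberTheory.EllipticCurves.TamagawaRingEquivProofs
import Literature.NumberTheory.EllipticCurves.RootNumberTwistProofs
import Literature.NumberTheory.EllipticCurves.SzpiroLocalDataProofs
import Literature.NumberTheory.EllipticCurves.BSDConductor
import Literature.NumberTheory.EllipticCurves.Greenberg1999.TwoTorsionMuInvariant
import Literature.NumberTheory.DiophantineGeometry.TateAlgorithmAdditiveProofs
import Literature.NumberTheory.DiophantineGeometry.TateAlgorithmTameTypesOddProofs
import Literature.NumberTheory.DiophantineGeometry.TateAlgorithmRingEquivProofs
import Literature.NumberTheory.DiophantineGeometry.ConductorAdditiveProofs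
import Literature.NumberTheory.DiophantineGeometry.ConductorRingOfIntegersProofs
import HarnessLib

/-!
# Full rational `2`-torsion forces `c_ℓ = 4`, Kodaira type `Iₙ*` and `f_ℓ = 2` at every odd additive prime

`Proofs`-style file (THEOREMS ONLY: no definition, no named fact, no instance). For a globally
minimal elliptic curve `W/ℚ` whose three points of order `2` are rational (three pairwise distinct
abscissae `x` with `HasRationalTwoTorsionX W x`, Greenberg's predicate) and an odd prime `ℓ` of
ADDITIVE reduction:

* `localTamagawaNumber_padic_eq_four_of_additive_of_fullTwoTorsion` — `c_ℓ = [E(ℚ_ℓ) : E₀(ℚ_ℓ)] = 4`: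
  the rational `2`-torsion `E(ℚ)[2] ≅ (ℤ/2)²` injects into `E(ℚ_ℓ)/E₁(ℚ_ℓ)` (the kernel of reduction
  `E₁(ℚ_ℓ)` has no `2`-torsion for `ℓ` odd, *AEC* VII.3.1), a group of order `c_ℓ · #Ẽ_ns(𝔽_ℓ) = c_ℓ · ℓ`
  (*AEC* VII.2.1 and Ex. 3.5, tree `index_formalFiltration_one_of_additive`); so `4 ∣ c_ℓ · ℓ`, `4 ∣ c_ℓ`,
  and `c_ℓ ≤ 4` (Kodaira–Néron, *AEC* VII.6.1) gives `c_ℓ = 4`;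
* `exists_kodairaSymbolAt_eq_Istar_of_additive_of_fullTwoTorsion` — the Kodaira type is `Iₙ*` (`n ≥ 0`):
  by Tate's algorithm the additive types `II, III, IV, IV*, III*, II*` have `c ∈ {1, 2, 3}` (tree facts
  `localTamagawaNumber_…_of_kodairaSymbolAt_eq_…_holds`, *ATAEC* IV.9.4 Steps 3–5, 8–10);
* `factorization_conductorNorm_eq_two_of_additive_of_fullTwoTorsion` — `ord_ℓ(N_E) = f_ℓ = 2`: types
  `Iₙ*` at `v ∤ 2` are tame (`conductorExponent_eq_two_of_kodairaSymbolAt`, *ATAEC* IV.11.1 for `p = 3`,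
  IV.10.4 for `p ≥ 5`); equivalently the wild part `δ_ℓ` vanishes because `ℚ(E[2]) = ℚ` is unramified —
  this file's route is the component group instead of the Swan conductor;
* `factorization_conductorNorm_le_two_of_ne_two_of_fullTwoTorsion` — hence `ord_ℓ(N_E) ≤ 2` at EVERY odd
  prime `ℓ` (no hypothesis on the reduction type).

Motivation (cell `bsd-rank2`, route `EisensteinDepletionAtTwo`, crux E1M, stub (A′) of line `cfsplit`): on the
CF habitat (full rational `2`-torsion) Matsuno's conductor sum `Σ_{ℓ∣N, ℓ≠2} ord_ℓ(N)·2^{n_ℓ}` (Prop. 6.2) is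
exponent-free, `ord_ℓ(N) ∈ {1, 2}`; the exponent-free rewriting lives in the Summits-side consumer.

References: J. H. Silverman, *AEC* (GTM 106, 2009) VII.2.1, VII.3.1, VII.6.1, Ex. 3.5 [SilvermanAEC2009];
J. H. Silverman, *ATAEC* (GTM 151, 1994) IV.9.4 and Table 4.1, IV.10.4, IV.11.1 [SilvermanATAEC1994].
-/

noncomputable section

open scoped Classical

open WeierstrassCurve IsDedekindDomain NumberField Rat.HeightOneSpectrum
  Literature.NumberTheory.EllipticCurves.Greenberg1999
  Literature.NumberTheory.DiophantineGeometry

namespace Literature.NumberTheory.EllipticCurves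

section Local

variable (W : WeierstrassCurve ℚ) [W.IsElliptic] [W.IsGloballyMinimal] (p : ℕ) [hp : Fact p.Prime]

omit [W.IsGloballyMinimal] hp in
/-- A rational point of order `2` with abscissa `x` (`HasRationalTwoTorsionX W x`: a rational affine
point `(x, y)` with `2y + a₁x + a₃ = 0`) is a point `T = (x, y) ∈ E(ℚ)` with `2 • T = O`.
[cite: SilvermanAEC2009, III.2.3 (group law: `-(x,y) = (x, -y - a₁x - a₃)`)] -/
theorem exists_point_two_nsmul_eq_zero_of_hasRationalTwoTorsionX {x : ℚ}
    (hx : HasRationalTwoTorsionX W x) :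
    ∃ (y : ℚ) (h : W.toAffine.Nonsingular x y), (2 : ℕ) • (Affine.Point.some x y h) = 0 := by
  obtain ⟨y, hxy, h2⟩ := hx
  have hns : W.toAffine.Nonsingular x y := (Affine.equation_iff_nonsingular (W := W.toAffine)).mp hxy
  refine ⟨y, hns, ?_⟩
  rw [two_nsmul]
  refine Affine.Point.add_self_of_Y_eq ?_
  change y = -y - W.a₁ * x - W.a₃
  linarith

/-- **`c_ℓ = 4` at an odd additive prime of a curve with full rational `2`-torsion.** For `W/ℚ`
globally minimal elliptic with three rational points of order `2` (pairwise distinct abscissae) and an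
odd prime `p` at which `W` is neither good nor multiplicative (additive reduction):
`[E(ℚ_p) : E₀(ℚ_p)] = 4`. Proof: `E(ℚ)[2] ≅ (ℤ/2)²` injects into `G = E(ℚ_p)/E₁(ℚ_p)` (`E₁(ℚ_p)`
has no `2`-torsion for odd `p`, *AEC* VII.3.1, tree `eq_zero_of_nsmul_eq_zero_of_isInReductionKernel`),
`#G = c_p · #Ẽ_ns(𝔽_p) = c_p · p` (*AEC* VII.2.1, Ex. 3.5; tree `index_formalFiltration_one_of_additive`),
so the `2`-primary part of `G` has order `2^m ≥ 4`, `4 ∣ c_p · p`, `4 ∣ c_p ≤ 4` (*AEC* VII.6.1).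
[cite: SilvermanAEC2009, VII.2.1, VII.3.1, VII.6.1 and Exercise 3.5] -/
theorem localTamagawaNumber_padic_eq_four_of_additive_of_fullTwoTorsion (hp2 : p ≠ 2)
    (hng : ¬ W.HasGoodReductionAtPrime p) (hnm : ¬ W.HasMultiplicativeReductionAtPrime p)
    (hfull : ∃ x₁ x₂ x₃ : ℚ, x₁ ≠ x₂ ∧ x₁ ≠ x₃ ∧ x₂ ≠ x₃ ∧ HasRationalTwoTorsionX W x₁ ∧
      HasRationalTwoTorsionX W x₂ ∧ HasRationalTwoTorsionX W x₃) :
    (W.baseChange ℚ_[p]).localTamagawaNumber ℤ_[p] = 4 := by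
  haveI : (W.baseChange ℚ_[p]).IsMinimal ℤ_[p] := isMinimal_map_padic_of_isGloballyMinimal W p
  haveI : (W.baseChange ℚ_[p]).IsElliptic := by rw [baseChange]; infer_instance
  set F1 := (W.baseChange ℚ_[p]).formalFiltration 1 with hF1
  set c := (W.baseChange ℚ_[p]).localTamagawaNumber ℤ_[p] with hc
  haveI hfi : F1.FiniteIndex := (W.baseChange ℚ_[p]).finiteIndex_formalFiltration 1
  have hidx : F1.index = c * p := index_formalFiltration_one_of_additive W p hng hnm
  have hc4 : c ≤ 4 := localTamagawaNumber_padic_le_four_of_not_mult W p hnm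
  set G := (W.baseChange ℚ_[p]).toAffine.Point ⧸ F1 with hG
  have hcardG : Nat.card G = c * p := hidx
  have hGpos : 0 < Nat.card G := by
    rw [hcardG]; exact Nat.pos_of_ne_zero (hidx ▸ hfi.index_ne_zero)
  haveI : Finite G := Nat.finite_of_card_ne_zero hGpos.ne'
  have hc0 : c ≠ 0 := fun h0 ↦ by rw [h0, zero_mul] at hcardG; exact hGpos.ne' hcardG
  -- the map `E(ℚ) → E(ℚ_p) → G`
  set π : (W.baseChange ℚ_[p]).toAffine.Point →+ G := QuotientAddGroup.mk' F1 with hπ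
  set φ : W.toAffine.Point →+ G := π.comp (W.toPadicPoint p) with hφ
  have hnd : ¬ p ∣ 2 := fun h ↦ hp2 ((Nat.prime_dvd_prime_iff_eq hp.out Nat.prime_two).mp h)
  -- a rational `2`-torsion point in the kernel of `φ` is `O`
  have hkey : ∀ P : W.toAffine.Point, (2 : ℕ) • P = 0 → φ P = 0 → P = 0 := by
    intro P h2 h0
    have hmem : W.toPadicPoint p P ∈ F1 := by
      rw [hφ, AddMonoidHom.comp_apply, hπ, QuotientAddGroup.mk'_apply,
        QuotientAddGroup.eq_zero_iff] at h0
      exact h0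
    have hker : (W.baseChange ℚ_[p]).IsInReductionKernel (W.toPadicPoint p P) := hmem.1
    have h2' : (2 : ℕ) • W.toPadicPoint p P = 0 := by rw [← map_nsmul, h2, map_zero]
    have h0' := (W.baseChange ℚ_[p]).eq_zero_of_nsmul_eq_zero_of_isInReductionKernel hnd hker h2'
    have hinj : Function.Injective (W.toPadicPoint p) :=
      Affine.Point.map_injective (W' := W.toAffine) (f := Algebra.ofId ℚ ℚ_[p])
    exact hinj (by rw [map_zero]; exact h0')
  -- the two independent rational `2`-torsion points
  obtain ⟨x₁, x₂, x₃, h12, -, -, hx₁, hx₂, -⟩ := hfull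
  obtain ⟨y₁, hn₁, hT₁⟩ := exists_point_two_nsmul_eq_zero_of_hasRationalTwoTorsionX W hx₁
  obtain ⟨y₂, hn₂, hT₂⟩ := exists_point_two_nsmul_eq_zero_of_hasRationalTwoTorsionX W hx₂
  set T₁ : W.toAffine.Point := Affine.Point.some x₁ y₁ hn₁ with hT₁def
  set T₂ : W.toAffine.Point := Affine.Point.some x₂ y₂ hn₂ with hT₂def
  have hT₁0 : T₁ ≠ 0 := Affine.Point.some_ne_zero hn₁
  have hT₂0 : T₂ ≠ 0 := Affine.Point.some_ne_zero hn₂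
  have hT12 : T₁ ≠ T₂ := by
    intro h
    rw [hT₁def, hT₂def] at h
    exact h12 (Affine.Point.some.injEq _ _ _ _ _ _ |>.mp h).1
  have hnegT₂ : -T₂ = T₂ := by
    rw [neg_eq_iff_add_eq_zero, ← two_nsmul]; exact hT₂
  have hsum : T₁ + T₂ ≠ 0 := by
    intro h
    exact hT12 (by rw [add_eq_zero_iff_eq_neg.mp h, hnegT₂])
  have h2sum : (2 : ℕ) • (T₁ + T₂) = 0 := by rw [nsmul_add, hT₁, hT₂, add_zero]
  -- their images `g₁, g₂, g₁ + g₂` in `G` are non-zero and pairwise distinct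
  set g₁ := φ T₁ with hg₁
  set g₂ := φ T₂ with hg₂
  have hg₁0 : g₁ ≠ 0 := fun h ↦ hT₁0 (hkey T₁ hT₁ h)
  have hg₂0 : g₂ ≠ 0 := fun h ↦ hT₂0 (hkey T₂ hT₂ h)
  have hg12 : g₁ ≠ g₂ := by
    intro h
    have h' : φ (T₁ - T₂) = 0 := by rw [map_sub, ← hg₁, ← hg₂, h, sub_self]
    have h2'' : (2 : ℕ) • (T₁ - T₂) = 0 := by rw [nsmul_sub, hT₁, hT₂, sub_self]
    exact hT12 (sub_eq_zero.mp (hkey _ h2'' h'))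
  have hgs0 : g₁ + g₂ ≠ 0 := fun h ↦ hsum (hkey _ h2sum (by rw [map_add]; exact h))
  have hgs1 : g₁ + g₂ ≠ g₁ := fun h ↦ hg₂0 (by simpa using h)
  have hgs2 : g₁ + g₂ ≠ g₂ := fun h ↦ hg₁0 (by simpa using h)
  -- the `2`-primary component `G₂` of `G` contains `{0, g₁, g₂, g₁ + g₂}`
  haveI : Fact (Nat.Prime 2) := ⟨Nat.prime_two⟩
  set G₂ := AddCommGroup.primaryComponent G 2 with hG₂
  have hmem : ∀ P : W.toAffine.Point, (2 : ℕ) • P = 0 → φ P ∈ G₂ := by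
    intro P h2
    rw [hG₂, AddCommGroup.mem_primaryComponent]
    exact ⟨1, by rw [pow_one, ← map_nsmul, h2, map_zero]⟩
  have hP2 : IsPGroup 2 (Multiplicative G₂) := by
    intro g
    obtain ⟨n, hn⟩ := (AddCommGroup.mem_primaryComponent).1 (Multiplicative.toAdd g).2
    refine ⟨n, Multiplicative.toAdd.injective ?_⟩
    rw [toAdd_pow, toAdd_one]
    exact Subtype.ext (by simpa using hn)
  obtain ⟨m, hm⟩ := IsPGroup.iff_card.1 hP2
  have hcardG₂ : Nat.card G₂ = 2 ^ m := hm
  -- `4 ≤ #G₂`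
  let S : Finset G := {0, g₁, g₂, g₁ + g₂}
  have hScard : S.card = 4 := by
    simp only [S]
    rw [Finset.card_insert_of_notMem, Finset.card_insert_of_notMem, Finset.card_insert_of_notMem,
      Finset.card_singleton]
    · simp only [Finset.mem_singleton]; exact fun h ↦ hgs2 h.symm
    · simp only [Finset.mem_insert, Finset.mem_singleton, not_or]; exact ⟨hg12, fun h ↦ hgs1 h.symm⟩
    · simp only [Finset.mem_insert, Finset.mem_singleton, not_or]
      exact ⟨fun h ↦ hg₁0 h.symm, fun h ↦ hg₂0 h.symm, fun h ↦ hgs0 h.symm⟩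
  have hSsub : ∀ s ∈ S, s ∈ G₂ := by
    intro s hs
    simp only [S, Finset.mem_insert, Finset.mem_singleton] at hs
    rcases hs with rfl | rfl | rfl | rfl
    · exact G₂.zero_mem
    · exact hmem T₁ hT₁
    · exact hmem T₂ hT₂
    · rw [hg₁, hg₂, ← map_add]; exact hmem _ h2sum
  haveI : Finite G₂ := inferInstance
  have h4le : 4 ≤ Nat.card G₂ := by
    let f : S → G₂ := fun s ↦ ⟨s.1, hSsub s.1 s.2⟩
    have hf : Function.Injective f := by
      intro a b h
      exact Subtype.ext (congrArg (fun x : G₂ ↦ (x : G)) h)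
    have := Nat.card_le_card_of_injective f hf
    rwa [Nat.card_eq_finsetCard, hScard] at this
  -- `4 ∣ #G₂ ∣ #G = c · p`, `p` odd, so `4 ∣ c`
  have h4dvd : 4 ∣ c * p := by
    have h2m : 2 ≤ m := by
      by_contra hlt
      have : 2 ^ m ≤ 2 ^ 1 := Nat.pow_le_pow_right (by norm_num) (by omega)
      rw [← hcardG₂] at this
      omega
    have h4 : (4 : ℕ) ∣ 2 ^ m := by
      rw [show (4 : ℕ) = 2 ^ 2 by norm_num]; exact pow_dvd_pow 2 h2m
    have hdvd : Nat.card G₂ ∣ Nat.card G :=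
      Dvd.intro_left _ G₂.card_eq_card_quotient_mul_card_addSubgroup.symm
    rw [hcardG₂, hcardG] at hdvd
    exact h4.trans hdvd
  have hcop : Nat.Coprime 4 p := by
    rw [show (4 : ℕ) = 2 ^ 2 by norm_num]
    exact (Nat.coprime_two_left.mpr (hp.out.odd_of_ne_two hp2)).pow_left 2
  have h4c : 4 ∣ c := hcop.dvd_of_dvd_mul_right h4dvd
  obtain ⟨k, hk⟩ := h4c
  rcases k with _ | k
  · exact absurd (by rw [hk]) hc0
  · have : k = 0 := by rw [hk] at hc4; omega
    subst this; rw [hk]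

end Local

/-! ## From `c_ℓ = 4` to the Kodaira type and the conductor exponent -/

section Conductor

variable (W : WeierstrassCurve ℚ) [W.IsElliptic] [W.IsGloballyMinimal] (p : ℕ) [hp : Fact p.Prime]

omit [W.IsGloballyMinimal] in
/-- The place of `𝓞 ℚ` above `p` has ADDITIVE reduction when `W` is neither good nor multiplicative at
the prime `p` (local trichotomy, *AEC* VII.5.1, and the tree's prime ↔ place bridges).
[cite: SilvermanAEC2009, VII.5 Prop. 5.1] -/
theorem hasAdditiveReductionAt_ringOfIntegers_of_additive (hng : ¬ W.HasGoodReductionAtPrime p)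
    (hnm : ¬ W.HasMultiplicativeReductionAtPrime p) :
    W.HasAdditiveReductionAt ((primesEquiv (R := 𝓞 ℚ)).symm ⟨p, hp.out⟩) := by
  set v : HeightOneSpectrum (𝓞 ℚ) := (primesEquiv (R := 𝓞 ℚ)).symm ⟨p, hp.out⟩ with hvdef
  have hv : primesEquiv v = ⟨p, hp.out⟩ := Equiv.apply_symm_apply _ _
  have hngv : ¬ W.HasGoodReductionAt v := by
    have key : ∀ q : Nat.Primes, primesEquiv v = q → W.HasGoodReductionAt v →
        (haveI := Fact.mk q.2; W.HasGoodReductionAtPrime (q : ℕ)) := by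
      rintro q rfl h
      exact (hasGoodReductionAtPrime_iff_hasGoodReductionAt_ringOfIntegers (v := v) W).mpr h
    exact fun h ↦ hng (key ⟨p, hp.out⟩ hv h)
  have hnmv : ¬ W.HasMultiplicativeReductionAt v := by
    have key : ∀ q : Nat.Primes, primesEquiv v = q → W.HasMultiplicativeReductionAt v →
        (haveI := Fact.mk q.2; W.HasMultiplicativeReductionAtPrime (q : ℕ)) := by
      rintro q rfl h
      exact (hasMultiplicativeReductionAtPrime_iff_hasMultiplicativeReductionAt_ringOfIntegers W v).mpr h
    exact fun h ↦ hnm (key ⟨p, hp.out⟩ hv h)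
  rcases hasGoodReductionAt_or_hasMultiplicativeReductionAt_or_hasAdditiveReductionAt v W with
    h | h | h
  · exact absurd h hngv
  · exact absurd h hnmv
  · exact h

omit [W.IsGloballyMinimal] in
/-- Conversely, ADDITIVE reduction at the place of `𝓞 ℚ` above `p` means `W` is neither good nor
multiplicative at the prime `p`. [cite: SilvermanAEC2009, VII.5 Prop. 5.1] -/
theorem not_good_not_mult_of_hasAdditiveReductionAt_ringOfIntegers
    (hadd : W.HasAdditiveReductionAt ((primesEquiv (R := 𝓞 ℚ)).symm ⟨p, hp.out⟩)) :
    ¬ W.HasGoodReductionAtPrime p ∧ ¬ W.HasMultiplicativeReductionAtPrime p := by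
  set v : HeightOneSpectrum (𝓞 ℚ) := (primesEquiv (R := 𝓞 ℚ)).symm ⟨p, hp.out⟩ with hvdef
  have hv : primesEquiv v = ⟨p, hp.out⟩ := Equiv.apply_symm_apply _ _
  have keyg : ∀ q : Nat.Primes, primesEquiv v = q →
      (haveI := Fact.mk q.2; W.HasGoodReductionAtPrime (q : ℕ)) → W.HasGoodReductionAt v := by
    rintro q rfl h
    exact (hasGoodReductionAtPrime_iff_hasGoodReductionAt_ringOfIntegers (v := v) W).mp h
  have keym : ∀ q : Nat.Primes, primesEquiv v = q →
      (haveI := Fact.mk q.2; W.HasMultiplicativeReductionAtPrime (q : ℕ)) →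
        W.HasMultiplicativeReductionAt v := by
    rintro q rfl h
    exact (hasMultiplicativeReductionAtPrime_iff_hasMultiplicativeReductionAt_ringOfIntegers W v).mp h
  exact ⟨fun h ↦ hadd.not_hasGoodReductionAt (keyg ⟨p, hp.out⟩ hv h),
    fun h ↦ hadd.not_hasMultiplicativeReductionAt (keym ⟨p, hp.out⟩ hv h)⟩

/-- **Kodaira type `Iₙ*` at an odd additive prime of a curve with full rational `2`-torsion.** With
`c_p = 4` (`localTamagawaNumber_padic_eq_four_of_additive_of_fullTwoTorsion`), Tate's algorithm leaves
only the types `I₀*`, `Iₙ*`: the other additive types have `c = 1` (`II`, `II*`), `c = 2` (`III`,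
`III*`) or `c ∈ {1, 3}` (`IV`, `IV*`) (*ATAEC* IV.9.4 Steps 3–5 and 8–10, tree facts
`localTamagawaNumber_…_holds`), at the place `v` of `𝓞 ℚ` above `p`.
[cite: SilvermanATAEC1994, IV.9.4 Steps 3–10 and Table 4.1 (PDF pp. 343–346)] -/
theorem exists_kodairaSymbolAt_eq_Istar_of_additive_of_fullTwoTorsion (hp2 : p ≠ 2)
    (hng : ¬ W.HasGoodReductionAtPrime p) (hnm : ¬ W.HasMultiplicativeReductionAtPrime p)
    (hfull : ∃ x₁ x₂ x₃ : ℚ, x₁ ≠ x₂ ∧ x₁ ≠ x₃ ∧ x₂ ≠ x₃ ∧ HasRationalTwoTorsionX W x₁ ∧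
      HasRationalTwoTorsionX W x₂ ∧ HasRationalTwoTorsionX W x₃) :
    ∃ n : ℕ, W.kodairaSymbolAt ((primesEquiv (R := 𝓞 ℚ)).symm ⟨p, hp.out⟩) = .Istar n := by
  set v : HeightOneSpectrum (𝓞 ℚ) := (primesEquiv (R := 𝓞 ℚ)).symm ⟨p, hp.out⟩ with hvdef
  have hv : primesEquiv v = ⟨p, hp.out⟩ := Equiv.apply_symm_apply _ _
  have hc4 : (W.baseChange (v.adicCompletion ℚ)).localTamagawaNumber (v.adicCompletionIntegers ℚ) = 4 := by
    rw [← localTamagawaNumber_padic_eq_holds W v p (congrArg Subtype.val hv)]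
    exact localTamagawaNumber_padic_eq_four_of_additive_of_fullTwoTorsion W p hp2 hng hnm hfull
  have hadd : W.HasAdditiveReductionAt v := hasAdditiveReductionAt_ringOfIntegers_of_additive W p hng hnm
  have hA : (W.kodairaSymbolAt v).IsAdditive := (W.isAdditive_kodairaSymbolAt_iff_holds v).mpr hadd
  -- case analysis on the symbol
  rcases hK : W.kodairaSymbolAt v with n | _ | _ | _ | n | _ | _ | _
  · -- `Iₙ`: good or multiplicative, not additive
    exfalso
    rw [hK] at hA
    rcases n with _ | n
    · exact hA.1 rfl
    · exact hA.2 ⟨n + 1, n.succ_ne_zero, rfl⟩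
  · exfalso
    have h := localTamagawaNumber_eq_one_of_kodairaSymbolAt_eq_II_holds v W hK
    omega
  · exfalso
    have h := localTamagawaNumber_eq_two_of_kodairaSymbolAt_eq_III_holds v W hK
    omega
  · exfalso
    have h := localTamagawaNumber_of_kodairaSymbolAt_eq_IV_holds v W hK
    omega
  · exact ⟨n, rfl⟩
  · exfalso
    have h := localTamagawaNumber_of_kodairaSymbolAt_eq_IVstar_holds v W hK
    omega
  · exfalso
    have h := localTamagawaNumber_eq_two_of_kodairaSymbolAt_eq_IIIstar_holds v W hK
    omega
  · exfalso
    have h := localTamagawaNumber_eq_one_of_kodairaSymbolAt_eq_IIstar_holds v W hK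
    omega

/-- **`f_p = 2` at an odd additive prime of a curve with full rational `2`-torsion**, at the place of
`ℤ` above `p`: Kodaira type `Iₙ*` at a place `v ∤ 2` has `ord_v(Δ_min) = m_v + 1`, hence Ogg's
`f_v = ord_v(Δ_min) + 1 − m_v = 2` (tree `conductorExponent_eq_two_of_kodairaSymbolAt`; *ATAEC*
Table 4.1 and the proof of IV.11.1 for `p = 3`). [cite: SilvermanATAEC1994, Table 4.1 and Thm. IV.11.1 (PDF pp. 367–368)] -/
theorem conductorExponent_eq_two_of_additive_of_fullTwoTorsion (hp2 : p ≠ 2)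
    (hng : ¬ W.HasGoodReductionAtPrime p) (hnm : ¬ W.HasMultiplicativeReductionAtPrime p)
    (hfull : ∃ x₁ x₂ x₃ : ℚ, x₁ ≠ x₂ ∧ x₁ ≠ x₃ ∧ x₂ ≠ x₃ ∧ HasRationalTwoTorsionX W x₁ ∧
      HasRationalTwoTorsionX W x₂ ∧ HasRationalTwoTorsionX W x₃) :
    W.conductorExponent ((primesEquiv (R := ℤ)).symm ⟨p, hp.out⟩) = 2 := by
  set v : HeightOneSpectrum ℤ := (primesEquiv (R := ℤ)).symm ⟨p, hp.out⟩ with hvdef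
  set v' : HeightOneSpectrum (𝓞 ℚ) := (primesEquiv (R := 𝓞 ℚ)).symm ⟨p, hp.out⟩ with hv'def
  have hv : primesEquiv v = ⟨p, hp.out⟩ := Equiv.apply_symm_apply _ _
  have hv' : primesEquiv v' = ⟨p, hp.out⟩ := Equiv.apply_symm_apply _ _
  obtain ⟨n, hn⟩ := exists_kodairaSymbolAt_eq_Istar_of_additive_of_fullTwoTorsion W p hp2 hng hnm hfull
  -- the Kodaira symbol at the place of `ℤ` is the same (both are the symbol of `W ⊗ ℚ_p` over `ℤ_p`)
  have hK : W.kodairaSymbolAt v = .Istar n := by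
    have h1 := W.kodairaSymbolAt_eq_padic v
    have h2 := W.kodairaSymbolAt_eq_padic v'
    rw [← hn]
    rw [h1, h2, hv, hv']
  have hgen : natGenerator v = p := congrArg Subtype.val hv
  have h2 : ringChar (ℤ ⧸ v.asIdeal) ≠ 2 := by
    rw [Rat.ringChar_int_quotient_asIdeal, hgen]; exact hp2
  exact W.conductorExponent_eq_two_of_kodairaSymbolAt v h2 (Or.inr (Or.inr ⟨n, hK⟩))

/-- **`ord_p(N_E) = 2` at an odd additive prime of a curve with full rational `2`-torsion**
(`N_E = W.conductorNorm ℤ`; `factorization_conductorNorm_primesEquiv_symm`).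
[cite: SilvermanATAEC1994, Table 4.1 and Thm. IV.11.1] -/
theorem factorization_conductorNorm_eq_two_of_additive_of_fullTwoTorsion (hp2 : p ≠ 2)
    (hng : ¬ W.HasGoodReductionAtPrime p) (hnm : ¬ W.HasMultiplicativeReductionAtPrime p)
    (hfull : ∃ x₁ x₂ x₃ : ℚ, x₁ ≠ x₂ ∧ x₁ ≠ x₃ ∧ x₂ ≠ x₃ ∧ HasRationalTwoTorsionX W x₁ ∧
      HasRationalTwoTorsionX W x₂ ∧ HasRationalTwoTorsionX W x₃) :
    (W.conductorNorm ℤ).factorization p = 2 := by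
  have h := factorization_conductorNorm_primesEquiv_symm W ⟨p, hp.out⟩
  rw [conductorExponent_eq_two_of_additive_of_fullTwoTorsion W p hp2 hng hnm hfull] at h
  exact h

/-- **`ord_p(N_E) ≤ 2` at every odd prime of a curve with full rational `2`-torsion** (no hypothesis on
the reduction type: `ord_p(N_E) ∈ {0, 1}` at good / multiplicative `p`, and `= 2` at additive `p`).
[cite: SilvermanATAEC1994, Thm. IV.10.2 and Thm. IV.11.1] -/
theorem factorization_conductorNorm_le_two_of_ne_two_of_fullTwoTorsion (hp2 : p ≠ 2)
    (hfull : ∃ x₁ x₂ x₃ : ℚ, x₁ ≠ x₂ ∧ x₁ ≠ x₃ ∧ x₂ ≠ x₃ ∧ HasRationalTwoTorsionX W x₁ ∧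
      HasRationalTwoTorsionX W x₂ ∧ HasRationalTwoTorsionX W x₃) :
    (W.conductorNorm ℤ).factorization p ≤ 2 := by
  by_cases hlt : (W.conductorNorm ℤ).factorization p < 2
  · exact hlt.le
  · -- `f_p ≥ 2`: additive at the place of `ℤ` above `p`, hence at the place of `𝓞 ℚ` above `p`
    push Not at hlt
    set v : HeightOneSpectrum ℤ := (primesEquiv (R := ℤ)).symm ⟨p, hp.out⟩ with hvdef
    set v' : HeightOneSpectrum (𝓞 ℚ) := (primesEquiv (R := 𝓞 ℚ)).symm ⟨p, hp.out⟩ with hv'def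
    have hv : primesEquiv v = ⟨p, hp.out⟩ := Equiv.apply_symm_apply _ _
    have hv' : primesEquiv v' = ⟨p, hp.out⟩ := Equiv.apply_symm_apply _ _
    have hf : (W.conductorNorm ℤ).factorization p = W.conductorExponent v :=
      factorization_conductorNorm_primesEquiv_symm W ⟨p, hp.out⟩
    have hff' : W.conductorExponent v = W.conductorExponent v' :=
      conductorExponent_eq_of_primesEquiv_eq v v' W (by rw [hv, hv'])
    have hadd' : W.HasAdditiveReductionAt v' :=
      (two_le_conductorExponent_iff_holds v' W).mp (by rw [← hff', ← hf]; exact hlt)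
    obtain ⟨hng, hnm⟩ := not_good_not_mult_of_hasAdditiveReductionAt_ringOfIntegers W p hadd'
    exact (factorization_conductorNorm_eq_two_of_additive_of_fullTwoTorsion W p hp2 hng hnm hfull).le

end Conductor

end Literature.NumberTheory.EllipticCurves

end
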